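import Mathlib
import HarnessLib
import Summits.SmoothPoincare4.SmoothPoincare4.Theses.ConvexBisection
import Summits.SmoothPoincare4.SmoothPoincare4.Theses.ConvexityLadder
import Literature.Topology.FourManifolds.Morse
import Literature.Topology.FourManifolds.BranchedDoubleQuotient

/-!
# Sketch — first lemmas of the three crux idea cards for
`ConvexBisection.ContractibleTwistedDoubleStandard` (stmt-SmoothPoincare4-3546), ideator 2, round 1.

Signatures only (they must elaborate); nothing here is proved or filed.
-/

open scoped Manifold ContDiff
open Literature.Topology.FourManifolds Literature.Geometry.Symplectic

noncomputable section

namespace Summit.SmoothPoincare4.SmoothPoincare4.Cruxes.ContractibleTwistedDoubleStandard.Sketch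

/-- Card `legendrian-belt-unlinking`, first lemma (STEIN REALISATION of presentation 5-manifolds):
every closed 4-manifold `M` bounding a compact contractible 5-dimensional 2-handlebody `V` is a
COMMON-CONTACT Stein bisection of ONE compact contractible Stein domain `(W, J)` glued to itself
(a contact double `D(W)`): Legendrian realisation of the relator link with free framings
(Gompf 1998 Thm 1.3 / Eliashberg) + `W × I ≅ V` (5-dimensional 2-handle uniqueness: homotopy ⇒
isotopy, framings in `π₁ SO(3)`).  Consequence: the crux implies `PresentationSpheresStandard`
(stmt-3717) — the Stein hypothesis is invisible on the doubles sector. -/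
def SteinRealisation : Prop :=
  ∀ (M : Type) [TopologicalSpace M] [T2Space M] [SecondCountableTopology M] [CompactSpace M]
    [ChartedSpace (EuclideanSpace ℝ (Fin 4)) M] [IsManifold (𝓡 4) ∞ M],
    (∃ (V : Type) (_ : TopologicalSpace V) (_ : T2Space V) (_ : SecondCountableTopology V)
        (_ : ChartedSpace (EuclideanHalfSpace (4 + 1)) V) (_ : IsManifold (𝓡∂ (4 + 1)) ∞ V)
        (_ : CompactSpace V), ContractibleSpace V ∧
        (∃ f : V → ℝ, IsMorseAdapted (𝓡∂ (4 + 1)) f ∧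
          ∀ z, IsMCriticalPt (𝓡∂ (4 + 1)) f z → morseIndex (𝓡∂ (4 + 1)) f z ≤ 2) ∧
        ∃ φ : M → V, Manifold.IsSmoothEmbedding (𝓡 4) (𝓡∂ (4 + 1)) ∞ φ ∧
          Set.range φ = (𝓡∂ (4 + 1)).boundary V) →
    ∃ (W : Type) (_ : TopologicalSpace W) (_ : ChartedSpace (EuclideanHalfSpace 4) W)
      (_ : IsManifold (𝓡∂ 4) ∞ W) (_ : CompactSpace W) (_ : ContractibleSpace W)
      (J : SteinStructure W) (e₁ e₂ : W → M),
      Manifold.IsSmoothEmbedding (𝓡∂ 4) (𝓡 4) ∞ e₁ ∧ Manifold.IsSmoothEmbedding (𝓡∂ 4) (𝓡 4) ∞ e₂ ∧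
      Set.range e₁ ∪ Set.range e₂ = Set.univ ∧
      Set.range e₁ ∩ Set.range e₂ = e₁ '' (𝓡∂ 4).boundary W ∧
      Set.range e₁ ∩ Set.range e₂ = e₂ '' (𝓡∂ 4).boundary W ∧
      (∀ w₁ w₂, e₁ w₁ = e₂ w₂ →
        Submodule.map (mfderiv (𝓡∂ 4) (𝓡 4) e₁ w₁).toLinearMap (contactPlane J.J w₁) =
          Submodule.map (mfderiv (𝓡∂ 4) (𝓡 4) e₂ w₂).toLinearMap (contactPlane J.J w₂))

/-- The doubles-sector reduction the card records: under `SteinRealisation`, the crux settles the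
shared crux `PresentationSpheresStandard` of routes ConvexityLadder / EntropyLadder /
RicciTranscript (compactness of `M ≃ₕ S⁴` is the proved fact
`compactSpace_of_homotopyEquiv_sphere_four`). -/
def DoublesSector : Prop :=
  SteinRealisation →
    Summit.SmoothPoincare4.SmoothPoincare4.Theses.ConvexBisection.ContractibleTwistedDoubleStandard →
      Summit.SmoothPoincare4.SmoothPoincare4.Theses.ConvexityLadder.PresentationSpheresStandard

/-- Card `property-r-mazur-halves`, first lemma / first target (MAZUR PAIR): the crux for two
Mazur-type halves — each `Wᵢ` carries a boundary-adapted Morse function with exactly one critical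
point of index 0, one of index 1, one of index 2 and none of higher index (one 1-handle, one
2-handle: all classical corks).  The card's engine (Gabai's Property R after cancelling the single
1-handle against `K` or against `Λ = ψ⁻¹(belt circle)`) proves it whenever one of the two framed
components of `K ∪ Λ ⊂ S¹ × S²` is slide-equivalent to a geometric generator. -/
def MazurPairStandard : Prop :=
  ∀ (X : Type) [TopologicalSpace X] [T2Space X] [SecondCountableTopology X] [CompactSpace X]
    [ChartedSpace (EuclideanSpace ℝ (Fin 4)) X] [IsManifold (𝓡 4) ∞ X]
    (W₁ : Type) [TopologicalSpace W₁] [ChartedSpace (EuclideanHalfSpace 4) W₁] [IsManifold (𝓡∂ 4) ∞ W₁]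
    [CompactSpace W₁] [ContractibleSpace W₁]
    (W₂ : Type) [TopologicalSpace W₂] [ChartedSpace (EuclideanHalfSpace 4) W₂] [IsManifold (𝓡∂ 4) ∞ W₂]
    [CompactSpace W₂] [ContractibleSpace W₂]
    (J₁ : SteinStructure W₁) (J₂ : SteinStructure W₂) (e₁ : W₁ → X) (e₂ : W₂ → X),
    (∃ f₁ : W₁ → ℝ, IsMorseAdapted (𝓡∂ 4) f₁ ∧
      (∀ z, IsMCriticalPt (𝓡∂ 4) f₁ z → morseIndex (𝓡∂ 4) f₁ z ≤ 2) ∧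
      (criticalSetOfIndex (𝓡∂ 4) f₁ 0).ncard = 1 ∧ (criticalSetOfIndex (𝓡∂ 4) f₁ 1).ncard = 1 ∧
      (criticalSetOfIndex (𝓡∂ 4) f₁ 2).ncard = 1) →
    (∃ f₂ : W₂ → ℝ, IsMorseAdapted (𝓡∂ 4) f₂ ∧
      (∀ z, IsMCriticalPt (𝓡∂ 4) f₂ z → morseIndex (𝓡∂ 4) f₂ z ≤ 2) ∧
      (criticalSetOfIndex (𝓡∂ 4) f₂ 0).ncard = 1 ∧ (criticalSetOfIndex (𝓡∂ 4) f₂ 1).ncard = 1 ∧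
      (criticalSetOfIndex (𝓡∂ 4) f₂ 2).ncard = 1) →
    Manifold.IsSmoothEmbedding (𝓡∂ 4) (𝓡 4) ∞ e₁ → Manifold.IsSmoothEmbedding (𝓡∂ 4) (𝓡 4) ∞ e₂ →
    Set.range e₁ ∪ Set.range e₂ = Set.univ →
    Set.range e₁ ∩ Set.range e₂ = e₁ '' (𝓡∂ 4).boundary W₁ →
    Set.range e₁ ∩ Set.range e₂ = e₂ '' (𝓡∂ 4).boundary W₂ →
    (∀ w₁ w₂, e₁ w₁ = e₂ w₂ →
      Submodule.map (mfderiv (𝓡∂ 4) (𝓡 4) e₁ w₁).toLinearMap (contactPlane J₁.J w₁) =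
        Submodule.map (mfderiv (𝓡∂ 4) (𝓡 4) e₂ w₂).toLinearMap (contactPlane J₂.J w₂)) →
    Nonempty (X ≃ₘ⟮𝓡 4, 𝓡 4⟯ Metric.sphere (0 : EuclideanSpace ℝ (Fin 5)) 1)

/-- Card `braided-branch-surface`, first lemma (HYPERELLIPTIC REALISATION, degree `d = 2`): if
both Stein halves carry `J`-holomorphic involutions `σᵢ` (deck transformations of Loi–Piergallini
double branched covers `Wᵢ → B⁴` along positively braided discs) which the seam identification
intertwines, then the contact twisted double `X` is — after re-charting on `ℂ²` — a branched double
cover of the round `S⁴` with the standard local model (`IsBranchedDoubleQuotient`), the branch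
surface being the union of the two braided discs.  (General degree `d` needs a simple-branched-cover
notion not yet in the tree: definition request.) -/
def HyperellipticRealisation : Prop :=
  ∀ (X : Type) [TopologicalSpace X] [T2Space X] [SecondCountableTopology X] [CompactSpace X]
    [ChartedSpace (EuclideanSpace ℝ (Fin 4)) X] [IsManifold (𝓡 4) ∞ X]
    (W₁ : Type) [TopologicalSpace W₁] [ChartedSpace (EuclideanHalfSpace 4) W₁] [IsManifold (𝓡∂ 4) ∞ W₁]
    [CompactSpace W₁] [ContractibleSpace W₁]
    (W₂ : Type) [TopologicalSpace W₂] [ChartedSpace (EuclideanHalfSpace 4) W₂] [IsManifold (𝓡∂ 4) ∞ W₂]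
    [CompactSpace W₂] [ContractibleSpace W₂]
    (J₁ : SteinStructure W₁) (J₂ : SteinStructure W₂) (e₁ : W₁ → X) (e₂ : W₂ → X)
    (σ₁ : W₁ → W₁) (σ₂ : W₂ → W₂),
    Manifold.IsSmoothEmbedding (𝓡∂ 4) (𝓡 4) ∞ e₁ → Manifold.IsSmoothEmbedding (𝓡∂ 4) (𝓡 4) ∞ e₂ →
    Set.range e₁ ∪ Set.range e₂ = Set.univ →
    Set.range e₁ ∩ Set.range e₂ = e₁ '' (𝓡∂ 4).boundary W₁ →
    Set.range e₁ ∩ Set.range e₂ = e₂ '' (𝓡∂ 4).boundary W₂ →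
    (∀ w₁ w₂, e₁ w₁ = e₂ w₂ →
      Submodule.map (mfderiv (𝓡∂ 4) (𝓡 4) e₁ w₁).toLinearMap (contactPlane J₁.J w₁) =
        Submodule.map (mfderiv (𝓡∂ 4) (𝓡 4) e₂ w₂).toLinearMap (contactPlane J₂.J w₂)) →
    -- σᵢ are smooth involutions, Jᵢ-holomorphic, with quotient the 4-ball (double covers of B⁴)
    ContMDiff (𝓡∂ 4) (𝓡∂ 4) ∞ σ₁ → ContMDiff (𝓡∂ 4) (𝓡∂ 4) ∞ σ₂ → σ₁ ∘ σ₁ = id → σ₂ ∘ σ₂ = id →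
    (∀ w, (J₁.J (σ₁ w)).comp (mfderiv (𝓡∂ 4) (𝓡∂ 4) σ₁ w) = (mfderiv (𝓡∂ 4) (𝓡∂ 4) σ₁ w).comp (J₁.J w)) →
    (∀ w, (J₂.J (σ₂ w)).comp (mfderiv (𝓡∂ 4) (𝓡∂ 4) σ₂ w) = (mfderiv (𝓡∂ 4) (𝓡∂ 4) σ₂ w).comp (J₂.J w)) →
    (∃ q₁ : W₁ → Metric.closedBall (0 : EuclideanSpace ℝ (Fin 4)) 1,
      Topology.IsQuotientMap q₁ ∧ ∀ a b, q₁ a = q₁ b ↔ b = a ∨ b = σ₁ a) →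
    (∃ q₂ : W₂ → Metric.closedBall (0 : EuclideanSpace ℝ (Fin 4)) 1,
      Topology.IsQuotientMap q₂ ∧ ∀ a b, q₂ a = q₂ b ↔ b = a ∨ b = σ₂ a) →
    -- the seam identification intertwines the involutions
    (∀ w₁ w₂, e₁ w₁ = e₂ w₂ → e₁ (σ₁ w₁) = e₂ (σ₂ w₂)) →
    ∃ (X' : Type) (_ : TopologicalSpace X') (_ : ChartedSpace (Fin 2 → ℂ) X')
      (_ : IsManifold 𝓘(ℝ, Fin 2 → ℂ) ∞ X') (Φ : X' ≃ₘ⟮𝓘(ℝ, Fin 2 → ℂ), 𝓡 4⟯ X) (σ : X' → X')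
      (q : X' → Metric.sphere (0 : EuclideanSpace ℝ (Fin 5)) 1),
      IsBranchedDoubleQuotient σ q ∧
      (∀ x' w₁, Φ x' = e₁ w₁ → Φ (σ x') = e₁ (σ₁ w₁)) ∧
      (∀ x' w₂, Φ x' = e₂ w₂ → Φ (σ x') = e₂ (σ₂ w₂))

end Summit.SmoothPoincare4.SmoothPoincare4.Cruxes.ContractibleTwistedDoubleStandard.Sketch

end
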